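import Summits.Ventures.LatticeQCDFlow.Scoring.LaplaceTorusLemmas
import Mathlib.Algebra.Order.Chebyshev
import HarnessLib

/-!
# Laplace's method on the `SU(N)` torus, I: the phases `φ_b(ψ)` (`φ_{i₀} = −Σψ`), the bound `(φ_j − φ_k)² ≤ 4(N−1) Π_k (1 + ψ_k²)`, and the integrable dominating function on `ℝ^{N−1}`

HONEST FRAMING: exact (Metropolis-corrected) sampling algorithms for lattice gauge theory;
figures of merit are autocorrelation/cost numbers at stated couplings and volumes; no
continuum-physics claim.

Venture `LatticeQCDFlow` (cell pub-lqcd), sub-topic `Scoring`; FANOUT row 5 (`s0-sun-a`), GEN-20.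
NEW WORK of the cell (placement rule).  The elementary inputs of the weak-coupling law of the `SU(N)` one-plaquette
partition function (sibling `SpecialUnitaryLaplace`): in GEN-17's free eigen-phases `ψ : {i ≠ i₀} → ℝ` of the
`SU(N)` torus, with the dependent phase `φ_{i₀}(ψ) = −Σ_k ψ_k` and `φ_b(ψ) = ψ_b` otherwise,

* `phase_smul`, `phase_div` (linearity), `abs_phase_le` (`|φ_b(ψ)| ≤ Σ_k|ψ_k|`), `sum_le_prod_one_add`
  (`Σ a_k ≤ Π(1 + a_k)`), **`phasePair_sq_le`** (`(φ_j(ψ) − φ_k(ψ))² ≤ 4|m| Π_k(1 + ψ_k²)`, `|m| = N − 1`, Cauchy–Schwarz),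
  **`mul_prod_le_suBound`** (`E Π_{j≺k} g_{jk} ≤ (4|m|)^{|OD|} Π_k e^{−(2/π²)ψ_k²}(1+ψ_k²)^{|OD|}` whenever
  `E ≤ Π_k e^{−(2/π²)ψ_k²}` and `0 ≤ g_{jk} ≤ (φ_j − φ_k)²`), **`integrable_suBound`** (that bound is integrable on `ℝ^{N−1}`).

No `def`, nothing cited as a fact, 0 sorry.
-/

noncomputable section

open Real MeasureTheory Filter Topology Finset
open Literature.RepresentationTheory.CompactGroups.WeylIntegration (OD enum)

namespace Summit.Ventures.LatticeQCDFlow.Scoring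

section SU

variable {n : Type*} [Fintype n] [DecidableEq n] (i₀ : n)

/-! ### 1. The phases `φ_b(ψ)` of the `SU(N)` torus and the dominating function -/

/-- The phases are linear: `φ_b(c·ψ) = c·φ_b(ψ)`. -/
theorem phase_smul (c : ℝ) (ψ : {i : n // i ≠ i₀} → ℝ) (b : n) :
    (if h : b = i₀ then -∑ k, (c • ψ) k else (c • ψ) ⟨b, h⟩ : ℝ)
      = c * (if h : b = i₀ then -∑ k, ψ k else ψ ⟨b, h⟩) := by
  by_cases hb : b = i₀
  · simp only [hb, dite_true, Pi.smul_apply, smul_eq_mul, ← Finset.mul_sum, mul_neg]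
  · simp only [hb, dite_false, Pi.smul_apply, smul_eq_mul]

/-- The phases divided: `φ_b(ψ)/√x = φ_b(ψ/√x)` in the form used by the change of variables. -/
theorem phase_div (x : ℝ) (ψ : {i : n // i ≠ i₀} → ℝ) (b : n) :
    (if h : b = i₀ then -∑ k, ψ k else ψ ⟨b, h⟩ : ℝ) / √x
      = (if h : b = i₀ then -∑ k, (fun k => ψ k / √x) k else (fun k => ψ k / √x) ⟨b, h⟩) := by
  by_cases hb : b = i₀
  · simp only [hb, dite_true, Finset.sum_div, neg_div]
  · simp only [hb, dite_false]

/-- Every phase is bounded by the `ℓ¹` norm of the free phases: `|φ_b(ψ)| ≤ Σ_k |ψ_k|`. -/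
theorem abs_phase_le (ψ : {i : n // i ≠ i₀} → ℝ) (b : n) :
    |(if h : b = i₀ then -∑ k, ψ k else ψ ⟨b, h⟩ : ℝ)| ≤ ∑ k, |ψ k| := by
  by_cases hb : b = i₀
  · simp only [hb, dite_true, abs_neg]
    exact Finset.abs_sum_le_sum_abs _ _
  · simp only [hb, dite_false]
    exact Finset.single_le_sum (f := fun k => |ψ k|) (fun k _ => abs_nonneg _) (Finset.mem_univ _)

/-- `Σ_k a_k ≤ Π_k (1 + a_k)` for non-negative `a`. -/
theorem sum_le_prod_one_add {ι : Type*} (s : Finset ι) {a : ι → ℝ} (ha : ∀ k, 0 ≤ a k) :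
    ∑ k ∈ s, a k ≤ ∏ k ∈ s, (1 + a k) := by
  classical
  induction s using Finset.induction_on with
  | empty => simp
  | @insert j s hj ih =>
    rw [Finset.sum_insert hj, Finset.prod_insert hj]
    have hP : 1 ≤ ∏ k ∈ s, (1 + a k) := Finset.one_le_prod fun k _ => by linarith [ha k]
    nlinarith [ha j]

/-- The squared phase differences are dominated by a product polynomial:
`(φ_j(ψ) − φ_k(ψ))² ≤ 4 |m| · Π_k (1 + ψ_k²)`, `|m| = N − 1` the number of free phases. -/
theorem phasePair_sq_le (ψ : {i : n // i ≠ i₀} → ℝ) (b b' : n) :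
    ((if h : b = i₀ then -∑ k, ψ k else ψ ⟨b, h⟩ : ℝ) - (if h : b' = i₀ then -∑ k, ψ k else ψ ⟨b', h⟩)) ^ 2
      ≤ 4 * Fintype.card {i : n // i ≠ i₀} * ∏ k : {i : n // i ≠ i₀}, (1 + ψ k ^ 2) := by
  set S : ℝ := ∑ k, |ψ k| with hS
  have h1 := abs_phase_le i₀ ψ b
  have h2 := abs_phase_le i₀ ψ b'
  have hS0 : 0 ≤ S := Finset.sum_nonneg fun k _ => abs_nonneg _
  -- `(φ_b − φ_b')² ≤ (2S)²`
  have hd : ((if h : b = i₀ then -∑ k, ψ k else ψ ⟨b, h⟩ : ℝ) - (if h : b' = i₀ then -∑ k, ψ k else ψ ⟨b', h⟩)) ^ 2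
      ≤ (2 * S) ^ 2 := by
    rw [← sq_abs]
    refine pow_le_pow_left₀ (abs_nonneg _) ((abs_sub _ _).trans (by linarith)) 2
  -- `S² ≤ |m| Σ ψ_k²` (Cauchy–Schwarz) and `Σ ψ_k² ≤ Π (1 + ψ_k²)`
  have hCS : S ^ 2 ≤ Fintype.card {i : n // i ≠ i₀} * ∑ k, ψ k ^ 2 := by
    have h := sq_sum_le_card_mul_sum_sq (s := (Finset.univ : Finset {i : n // i ≠ i₀})) (f := fun k => |ψ k|)
    simp only [sq_abs, Finset.card_univ] at h
    exact h
  have hsum : ∑ k, ψ k ^ 2 ≤ ∏ k : {i : n // i ≠ i₀}, (1 + ψ k ^ 2) :=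
    sum_le_prod_one_add _ fun k => sq_nonneg _
  have hm : (0 : ℝ) ≤ Fintype.card {i : n // i ≠ i₀} := Nat.cast_nonneg _
  nlinarith [mul_le_mul_of_nonneg_left hsum hm]

/-- The `SU(N)` Laplace bound: if `E ≤ Π_k e^{−(2/π²)ψ_k²}` and `0 ≤ g_{jk} ≤ (φ_j(ψ) − φ_k(ψ))²`, then
`E · Π_{j≺k} g_{jk} ≤ (4|m|)^{|OD|} Π_k e^{−(2/π²)ψ_k²}(1 + ψ_k²)^{|OD|}`. -/
theorem mul_prod_le_suBound (ψ : {i : n // i ≠ i₀} → ℝ) {E : ℝ}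
    (hE : E ≤ ∏ k : {i : n // i ≠ i₀}, Real.exp (-(2 / π ^ 2 * ψ k ^ 2))) {g : OD n → ℝ} (hg0 : ∀ p, 0 ≤ g p)
    (hg : ∀ p : OD n, g p ≤ ((if h : p.1.1 = i₀ then -∑ k, ψ k else ψ ⟨p.1.1, h⟩ : ℝ) -
      (if h : p.1.2 = i₀ then -∑ k, ψ k else ψ ⟨p.1.2, h⟩)) ^ 2) :
    E * ∏ p, g p ≤ (4 * Fintype.card {i : n // i ≠ i₀}) ^ Fintype.card (OD n) *
      ∏ k : {i : n // i ≠ i₀}, (Real.exp (-(2 / π ^ 2 * ψ k ^ 2)) * (1 + ψ k ^ 2) ^ Fintype.card (OD n)) := by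
  set P : ℝ := ∏ k : {i : n // i ≠ i₀}, (1 + ψ k ^ 2) with hP
  have hpair : ∀ p : OD n, g p ≤ 4 * Fintype.card {i : n // i ≠ i₀} * P :=
    fun p => (hg p).trans (phasePair_sq_le i₀ ψ _ _)
  have hc : ∏ _p : OD n, (4 * Fintype.card {i : n // i ≠ i₀} * P)
      = (4 * Fintype.card {i : n // i ≠ i₀} * P) ^ Fintype.card (OD n) := by
    rw [Finset.prod_const, Finset.card_univ]
  have hprod : ∏ p, g p ≤ (4 * Fintype.card {i : n // i ≠ i₀}) ^ Fintype.card (OD n) * P ^ Fintype.card (OD n) := by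
    rw [← mul_pow, ← hc]
    exact Finset.prod_le_prod (fun p _ => hg0 p) fun p _ => hpair p
  calc E * ∏ p, g p ≤ (∏ k : {i : n // i ≠ i₀}, Real.exp (-(2 / π ^ 2 * ψ k ^ 2))) *
        ((4 * Fintype.card {i : n // i ≠ i₀}) ^ Fintype.card (OD n) * P ^ Fintype.card (OD n)) :=
        mul_le_mul hE hprod (Finset.prod_nonneg fun p _ => hg0 p) (Finset.prod_nonneg fun b _ => (Real.exp_pos _).le)
    _ = (4 * Fintype.card {i : n // i ≠ i₀}) ^ Fintype.card (OD n) *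
        ∏ k : {i : n // i ≠ i₀}, (Real.exp (-(2 / π ^ 2 * ψ k ^ 2)) * (1 + ψ k ^ 2) ^ Fintype.card (OD n)) := by
        rw [hP, ← Finset.prod_pow, Finset.prod_mul_distrib]
        ring

/-- The dominating function is integrable on `ℝ^{N−1}`. -/
theorem integrable_suBound :
    Integrable (fun ψ : {i : n // i ≠ i₀} → ℝ => ((4 : ℝ) * Fintype.card {i : n // i ≠ i₀}) ^ Fintype.card (OD n) *
      ∏ k : {i : n // i ≠ i₀}, (Real.exp (-(2 / π ^ 2 * ψ k ^ 2)) * (1 + ψ k ^ 2) ^ Fintype.card (OD n))) := by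
  refine Integrable.const_mul ?_ _
  rw [volume_pi]
  refine Integrable.fintype_prod (f := fun _ t => Real.exp (-(2 / π ^ 2 * t ^ 2)) * (1 + t ^ 2) ^ Fintype.card (OD n))
    fun b => ?_
  have hc : (0 : ℝ) < 2 / π ^ 2 := by positivity
  set M := Fintype.card (OD n)
  have hg : Integrable (fun t : ℝ => (M.factorial * (2 / (2 / π ^ 2)) ^ M * Real.exp ((2 / π ^ 2) / 2)) *
      Real.exp (-((2 / π ^ 2) / 2 * t ^ 2))) := by
    refine Integrable.const_mul ?_ _
    have h := integrable_exp_neg_mul_sq (b := (2 / π ^ 2) / 2) (by positivity)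
    refine h.congr (Eventually.of_forall fun t => ?_)
    simp only [neg_mul]
  refine Integrable.mono' hg ((by fun_prop : Continuous fun t : ℝ =>
      Real.exp (-(2 / π ^ 2 * t ^ 2)) * (1 + t ^ 2) ^ M).aestronglyMeasurable) (Eventually.of_forall fun t => ?_)
  rw [Real.norm_eq_abs, abs_of_nonneg (by positivity), mul_comm]
  exact one_add_sq_pow_mul_exp_le hc M t

end SU

end Summit.Ventures.LatticeQCDFlow.Scoring
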